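import Mathlib
import HarnessLib
import Summits.HubbardSuperconductivity.HubbardSuperconductivity.Theorems.KLProgrammeKLRegimeEngineTowerInstProfileLevRateFBase
import Summits.HubbardSuperconductivity.HubbardSuperconductivity.Theorems.KLProgrammeKLRegimeEngineTowerLevNumericsG

/-!
# Route `KLProgramme` — crux K3 ENGINE (stmt-HubbardSuperconductivity-20437 `KLRegimeEngineV17F2`), stub (b) v2, THE LEVELS PACKAGE (ℓ):
# THE FLOOR-KEYED, RE-BASED LEVELLED TOWER LAW WITH ITS NUMERICS AND ITS BLOCK-1 PROFILE CLOSED («(I5)-F», the model F-assembly)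
# (cell gate-hubbard-kl, seat hubbard-kl-k3c3-p2 g15; composition of p4 g19's `klTowerBLevF_le_law_of_base_rows` (…TowerInstProfileLevRateFBase) with the
#  generic (I5) rows `towerLevNumericsG_rows/_side_of_lam_le/_side_of_doors` (…TowerLevNumericsG, k3c3-p2 g14); E1's (I5) by the substitute precedent)

WHAT.  `klTowerBLevF_le_law_of_base_rows` (p4) = the kit (T3-P) on the FLOOR-keyed arrays `klTowerBLevF/klTowerMuLevF` (located-risk #10 «(ℓ)-LEV-ODD» cure (ε))
re-based at `𝒱_d` (located-risk #8 «(ℓ)-BLOCK0-LOGM» cure (A″)) with the bridge `hR` DISCHARGED, modulo NAMED inputs: the base datum `N_b` of `𝒱_d` at `F_{d−1}` with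
its unit law (`hcar`/`hlawb`, k3c2-p3 «(ℓ)-BASE-LEV»), the block-1 profile (`hbase`/`hbase3`), the imports `ι₁ ι₂` (E1 (I4)), the located six-leg cell `X`, the floor
step (`hstep` = the «(I1)-LEV-FLOOR» LINK, to come), two floors on `(A′, Q′)`, two on `ι₃`, and the kit's eight numerics.  Here everything arithmetical is CLOSED:

* §1 `klTowerMeasLev_le_of_levelBound`, **`klTowerMuLevF_one_le_of_baseRows`** — the block-1 profile IS the base datum: from `hcar`/`hlawb`,
  `klTowerMuLevF … d 1 m ≤ 27⁵·A_b·λ^{m−1}·Q_b^m` (`m ≥ 3`), so `hbase`/`hbase3` are discharged by the floors `W·27⁵·A_b ≤ A′`, `Z·Q_b ≤ Q′`, `A′Q′³ ≤ ι₃`;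
* §2 **`klTowerBLevF_le_law_lev_of_rows`** — the law with the explicit (I5)-F choices (equational binders, instantiate with `rfl`; `κ := W·27⁵·(C₁/C₂)·8^{d−1}`,
  rate `r = (2^d)⁻¹`):
  `ρ = max 4 (2τψ)`, `Q′ = Z·Q_b + 1`, `Q = ρ·Q′`, `Y = ι₂/(2Q′) + W·Z³·X/(4Q′²) + (W·27⁵·A_b + κ·A_b)·Q′/2`, `A = 2Y(1 − r)/(κ·Q′)`, `A′ = (W·27⁵·A_b + κ·A_b) + 2Y/Q′`,
  `ι₃ = W·Z³·X + A′Q′³`; what remains NUMERICAL: the BLOCKING row `max 1 Z · C₂² · max 4 (2τψ) ≤ 2^{d−1}` (choice of `d`, `towerLevNumericsG_exists_blocking`),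
  the AMPLITUDE rows `8·Φ·τ·Y ≤ 1`, `128·e·ψ³·τ⁴·Φ·κ·Y ≤ (1 − r)·ρ³` (choice of `B` in `λ = B·ε`, `towerLevNumericsG_amp_of_le_B`), and the coupling smallness
  `λ ≤ λ₀` (the seven-entry `min`-chain); §3 **`klTowerBLevF_le_law_lev_of_doors`** — the same at `λ := B·epsCoupling P U j` in the KL regime from the U-door
  `U ≤ λ₀/(2·B·Klam + 1)` and the c-door `cc ≤ λ₀·log 4/(2·B·Klam + 1)`.
⊢ `∀ 2 ≤ k ≤ K_b, ∀ t, ∀ 3 ≤ p ≤ D, klTowerBLevF … d t k p ≤ A·λ^{p−1}·Q^p`.  The ONLY structural input left is `hstep` (the floor LINK); `N_b`, `ι₁ ι₂`, `X` are E1's data.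
Composition of landed theorems; nothing about the model is asserted beyond them and the named inputs; nothing asserts (ℓ), any stub, K3 or superconductivity.
References: BGM 2006 §2.8 (2.83), (2.93)–(2.98), Lemma 2.5 [cite: BenfattoGiulianiMastropietro2006].
-/

noncomputable section

namespace Summit.HubbardSuperconductivity.HubbardSuperconductivity.Theorems.EngineV8

set_option linter.dupNamespace false -- summit = problem name (single-conjunct summit), D-0017

open Classical
open Real Finset Literature.MathematicalPhysics.QuantumLattice Literature.Probability.LatticeModels GrassmannAlgebra
open Literature.MathematicalPhysics.QuantumLattice.FermiRG
open Summit.HubbardSuperconductivity.HubbardSuperconductivity.Theorems.KLProgrammeLegKernels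
open Summit.HubbardSuperconductivity.HubbardSuperconductivity.Theorems.KLRegimeSplit
open Summit.HubbardSuperconductivity.HubbardSuperconductivity.Theorems.KLRegimeWick
open Summit.HubbardSuperconductivity.HubbardSuperconductivity.Theorems.TorusFourierL2
open Summit.HubbardSuperconductivity.HubbardSuperconductivity.Theorems.DispersionFlow

variable {L M : ℕ} [NeZero L] [NeZero M]

/-! ## §1 The block-1 profile is the base datum -/

omit [NeZero M] in
/-- A common bound on the levelled norms of one level of the block input bounds the measured levelled size of that level. -/
theorem klTowerMeasLev_le_of_levelBound (β U μ : ℝ) (K : TrigPolyC4v) (d k m F : ℕ) {B : ℝ} (hB : 0 ≤ B)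
    (h : ∀ Ωe : Fin m → Option (SectorLeg (sectorCount (d * k - 1))), levelCount Ωe = F →
      klLevNormOf L M β μ K (d * k - 1) m (klTowerInput L M β U μ K d k) Ωe ≤ B) :
    klTowerMeasLev L M β U μ K d k m F ≤ B := by
  unfold klTowerMeasLev
  rcases isEmpty_or_nonempty {Ωe : Fin m → Option (SectorLeg (sectorCount (d * k - 1))) // levelCount Ωe = F} with hE | hE
  · rw [Real.iSup_of_isEmpty]; exact hB
  · exact ciSup_le fun Ωe => h Ωe.1 Ωe.2

/-- **THE BLOCK-1 PROFILE FROM THE BASE DATUM**: if the levelled norms of `𝒱_d` at `F_{d−1}` of level `t + 1` in degree `2p` are `≤ N_b t p` and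
`N_b t p / klLevUnitF … t p (d−1) ≤ A_b·λ^{p−1}·Q_b^p` for `p ≥ 3`, then `klTowerMuLevF … d 1 m ≤ 27⁵·A_b·λ^{m−1}·Q_b^m` for every `m ≥ 3` (`0 < β`, `A_b, λ, Q_b ≥ 0`).
[cite: BenfattoGiulianiMastropietro2006, §2.8 (2.83), (2.93)-(2.98)] -/
theorem klTowerMuLevF_one_le_of_baseRows {β : ℝ} (hβ : 0 < β) (U μ : ℝ) (K : TrigPolyC4v) (d : ℕ) {lam Ab Qb : ℝ} (hlam : 0 ≤ lam) (hAb : 0 ≤ Ab)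
    (hQb : 0 ≤ Qb) (Nb : Fin 5 → ℕ → ℝ) (hNb0 : ∀ t p, 0 ≤ Nb t p)
    (hcar : ∀ (t : Fin 5) (p : ℕ) (Ωe' : Fin (2 * p) → Option (SectorLeg (sectorCount (d - 1)))), levelCount Ωe' = (t : ℕ) + 1 →
      klLevNormOf L M β μ K (d - 1) (2 * p) (klTowerInput L M β U μ K d 1) Ωe' ≤ Nb t p)
    (hlawb : ∀ (t : Fin 5) (p : ℕ), 3 ≤ p → Nb t p / klLevUnitF β M t p (d - 1) ≤ Ab * lam ^ (p - 1) * Qb ^ p) {m : ℕ} (hm : 3 ≤ m) :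
    klTowerMuLevF L M β U μ K d 1 m ≤ (27 : ℝ) ^ 5 * Ab * lam ^ (m - 1) * Qb ^ m := by
  have hprof0 : 0 ≤ Ab * lam ^ (m - 1) * Qb ^ m := by positivity
  unfold klTowerMuLevF
  refine Finset.sup'_le _ _ fun t _ => ?_
  have hcar1 : ∀ Ωe : Fin (2 * m) → Option (SectorLeg (sectorCount (d * 1 - 1))), levelCount Ωe = (t : ℕ) + 1 →
      klLevNormOf L M β μ K (d * 1 - 1) (2 * m) (klTowerInput L M β U μ K d 1) Ωe ≤ Nb t m := by
    rw [Nat.mul_one]; exact hcar t m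
  have hmeas : klTowerMeasLev L M β U μ K d 1 (2 * m) ((t : ℕ) + 1) ≤ Nb t m :=
    klTowerMeasLev_le_of_levelBound β U μ K d 1 (2 * m) ((t : ℕ) + 1) (hNb0 t m) hcar1
  have hu : 0 < klLevUnitF β M t m (d - 1) := klLevUnitF_pos hβ t m _
  have h27 : (27 : ℝ) ^ ((t : ℕ) + 1) ≤ (27 : ℝ) ^ 5 := pow_le_pow_right₀ (by norm_num) (by have := t.2; omega)
  unfold klTowerMuLevAtF
  rw [Nat.mul_one]
  calc (27 : ℝ) ^ ((t : ℕ) + 1) * klTowerMeasLev L M β U μ K d 1 (2 * m) ((t : ℕ) + 1) / klLevUnitF β M t m (d - 1)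
      = (27 : ℝ) ^ ((t : ℕ) + 1) * (klTowerMeasLev L M β U μ K d 1 (2 * m) ((t : ℕ) + 1) / klLevUnitF β M t m (d - 1)) := by ring
    _ ≤ (27 : ℝ) ^ ((t : ℕ) + 1) * (Nb t m / klLevUnitF β M t m (d - 1)) :=
        mul_le_mul_of_nonneg_left (div_le_div_of_nonneg_right hmeas hu.le) (by positivity)
    _ ≤ (27 : ℝ) ^ ((t : ℕ) + 1) * (Ab * lam ^ (m - 1) * Qb ^ m) := mul_le_mul_of_nonneg_left (hlawb t m hm) (by positivity)
    _ ≤ (27 : ℝ) ^ 5 * (Ab * lam ^ (m - 1) * Qb ^ m) := mul_le_mul_of_nonneg_right h27 hprof0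
    _ = (27 : ℝ) ^ 5 * Ab * lam ^ (m - 1) * Qb ^ m := by ring

/-! ## §2 The floor-keyed law with numerics and block-1 profile closed, `λ ≤ λ₀` form -/

/-- **THE FLOOR-KEYED RE-BASED LEVELLED TOWER LAW, NUMERICS CLOSED, `λ ≤ λ₀` FORM** (see the module docstring; the equational binders are the explicit (I5)-F
choices, `rfl` at the call; `κ` abbreviates `W·27⁵·(C₁/C₂)·8^{d−1}`). [cite: BenfattoGiulianiMastropietro2006, §2.8 (2.83), (2.93)-(2.98)] -/
theorem klTowerBLevF_le_law_lev_of_rows :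
    ∃ C₁ C₂ : ℝ, 0 < C₁ ∧ 0 < C₂ ∧ ∀ R : RenConsts, R.WF2 → ∃ c₃' : ℝ, 0 < c₃' ∧ ∃ U₀' : ℝ, 0 < U₀' ∧
      ∀ (P : SplitConsts) (c : ℝ), P.WF → 0 < c → c ≤ klEngC₃6 P R → c ≤ c₃' →
      ∀ μ ∈ klWindowC, ∀ U : ℝ, 0 < U → U ≤ klEngU₀9 P R c → U ≤ U₀' → ∀ β : ℝ, klBetaMin ≤ β → β ≤ Real.exp (c / U ^ 2) →
      ∀ K : TrigPolyC4v, FrameOK R U (nScales β) μ K → ∀ (L M : ℕ) [NeZero L] [NeZero M],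
      klEngL₃ β U ≤ L → klEngM₃ β U L ≤ M → ∀ d Kb D : ℕ, 2 ≤ d → d * Kb - 1 ≤ nScales β + 1 → 3 ≤ D →
      ∀ (lam Ab Qb : ℝ), 0 < lam → 0 < Ab → 0 ≤ Qb →
      -- the base datum at the family `F_{d−1}` and its unit law (k3c2-p3 «(ℓ)-BASE-LEV» p668143 / p670020 from p3's grid step)
      ∀ Nb : Fin 5 → ℕ → ℝ, (∀ t p, 0 ≤ Nb t p) →
        (∀ (t : Fin 5) (p : ℕ) (Ωe' : Fin (2 * p) → Option (SectorLeg (sectorCount (d - 1)))), levelCount Ωe' = (t : ℕ) + 1 →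
          klLevNormOf L M β μ K (d - 1) (2 * p) (klTowerInput L M β U μ K d 1) Ωe' ≤ Nb t p) →
        (∀ (t : Fin 5) (p : ℕ), 3 ≤ p → Nb t p / klLevUnitF β M t p (d - 1) ≤ Ab * lam ^ (p - 1) * Qb ^ p) →
      ∀ (W Z σ Φ ψ τ ι₁ ι₂ X : ℝ), 0 < W → 0 < Z → 0 ≤ σ → 0 ≤ Φ → 0 ≤ ψ → 0 < τ → 0 ≤ ι₁ → 0 ≤ ι₂ → 0 ≤ X →
      -- the explicit (I5)-F choices (equational binders)
      ∀ (ρ Q' Q κ Y A A' ι₃ : ℝ), ρ = max 4 (2 * τ * ψ) → Q' = Z * Qb + 1 → Q = ρ * Q' →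
        κ = W * ((27 : ℝ) ^ 5 * (C₁ / C₂) * (8 : ℝ) ^ (d - 1)) →
        Y = ι₂ / (2 * Q') + W * Z ^ 3 * X / (4 * Q' ^ 2) + (W * (27 : ℝ) ^ 5 * Ab + κ * Ab) * Q' / 2 →
        A = 2 * Y * (1 - ((2 : ℝ) ^ d)⁻¹) / (κ * Q') →
        A' = (W * (27 : ℝ) ^ 5 * Ab + κ * Ab) + 2 * Y / Q' → ι₃ = W * Z ^ 3 * X + A' * Q' ^ 3 →
      -- the BLOCKING row and the two AMPLITUDE rows
      max 1 Z * C₂ ^ 2 * max 4 (2 * τ * ψ) ≤ (2 : ℝ) ^ (d - 1) → 8 * Φ * τ * Y ≤ 1 →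
        128 * exp 1 * ψ ^ 3 * τ ^ 4 * Φ * κ * Y ≤ (1 - ((2 : ℝ) ^ d)⁻¹) * ρ ^ 3 →
      -- the imports (E1 (I4))
      (∀ k, 1 ≤ k → k < Kb → W * Z ^ 1 * klTowerMuLevF L M β U μ K d k 1 ≤ ι₁ * lam) →
      (∀ k, 1 ≤ k → k < Kb → W * Z ^ 2 * klTowerMuLevF L M β U μ K d k 2 ≤ ι₂ * lam) →
      -- the located six-leg cell «(I2)-F1-HMU» at the blocks `k ≥ 2`
      (∀ k, 2 ≤ k → k < Kb → klTowerMuLevAtF L M β U μ K d 0 k 3 ≤ X * lam ^ 2) →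
      -- the floor step at blocks `k ≥ 1` (the «(I1)-LEV-FLOOR» LINK)
      (∀ t : Fin 5, ∀ k, 1 ≤ k → k < Kb → ∀ N : ℕ, 2 ≤ N → ∀ p, 3 ≤ p → p ≤ D →
        Φ * towerV D τ (fun m => W * Z ^ m * klTowerMuLevF L M β U μ K d k m) < 1 →
        klTowerBLevF L M β U μ K d t (k + 1) p ≤
          towerFO D σ (fun m => W * Z ^ m * klTowerMuLevF L M β U μ K d k m) p +
            ∑ n ∈ Icc 2 N, exp 1 * Φ ^ (n - 1) * ψ ^ p * towerS D τ (fun m => W * Z ^ m * klTowerMuLevF L M β U μ K d k m) n p +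
            ψ ^ p * exp 1 * towerV D τ (fun m => W * Z ^ m * klTowerMuLevF L M β U μ K d k m) *
              (Φ * towerV D τ (fun m => W * Z ^ m * klTowerMuLevF L M β U μ K d k m)) ^ N /
              (1 - Φ * towerV D τ (fun m => W * Z ^ m * klTowerMuLevF L M β U μ K d k m))) →
      -- the coupling smallness `λ ≤ λ₀`
      lam ≤ min 1 (min (1 / (8 * σ * Q' + 1)) (min (1 / (2 * exp 1 * τ * Q' + 1)) (min (1 / (4 * Φ * τ * ι₁ + 1))
        (min (1 / (2 * (Φ * (exp 1 * τ * ι₁ + (exp 1 * τ) ^ 2 * ι₂ + (exp 1 * τ) ^ 3 * ι₃ + A' * (exp 1 * τ * Q') ^ 2 / 2)) + 1))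
          (min (A * Q ^ 3 / (16 * σ * Q' * A' * (4 * Q') ^ 3 + A * Q ^ 3))
            (A * Q ^ 3 / (16 * exp 1 * ψ * (2 * τ * ψ * Q') ^ 2 * Φ * τ ^ 2 * ι₁ ^ 2 + A * Q ^ 3))))))) →
      ∀ k, 2 ≤ k → k ≤ Kb → ∀ (t : Fin 5) (p : ℕ), 3 ≤ p → p ≤ D → klTowerBLevF L M β U μ K d t k p ≤ A * lam ^ (p - 1) * Q ^ p := by
  obtain ⟨C₁, C₂, hC₁, hC₂, h⟩ := klTowerBLevF_le_law_of_base_rows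
  refine ⟨C₁, C₂, hC₁, hC₂, fun R hR2 => ?_⟩
  obtain ⟨c₃, hc₃, U₀, hU₀, h'⟩ := h R hR2
  refine ⟨c₃, hc₃, U₀, hU₀, ?_⟩
  intro P c hP hc hc6 hc₃' μ hμ U hU hU9 hU₀' β hβmin hβc K hK L M _ _ hL3 hM3 d Kb D hd hKbN hD lam Ab Qb hlam hAb hQb Nb hNb0 hcar hlawb
    W Z σ Φ ψ τ ι₁ ι₂ X hW hZ hσ hΦ hψ hτ hι₁ hι₂ hX ρ Q' Q κ Y A A' ι₃ hρ hQ' hQ hκ hY hA hA' hι₃ hblock amp1 amp2 himp₁ himp₂ hcell hstep hle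
  have hβ : 0 < β := KLRegimeSplit.pos_of_klBetaMin_le hβmin
  -- the generic (I5) rows at `κ_A := κ`, `a₁ := W·27⁵·A_b`, `a₂ := A_b`, `Q_uv := Q_b`, `q₀ := 0`, `κ_Q := C₂²·(2^{d−1})⁻¹`, `r := (2^d)⁻¹`
  have hκ0 : 0 < κ := by rw [hκ]; positivity
  have ha₁ : 0 < W * (27 : ℝ) ^ 5 * Ab := by positivity
  have hr1 : ((2 : ℝ) ^ d)⁻¹ < 1 := inv_lt_one_of_one_lt₀ (one_lt_pow₀ (by norm_num) (by omega))
  have hκQ : 0 ≤ C₂ ^ 2 * ((2 : ℝ) ^ (d - 1))⁻¹ := by positivity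
  have hQ'' : Q' = Z * Qb + 0 + 1 := by rw [hQ', add_zero]
  have ha : W * (27 : ℝ) ^ 5 * Ab + κ * Ab = W * (27 : ℝ) ^ 5 * Ab + κ * Ab := rfl
  have h2d : (0 : ℝ) < (2 : ℝ) ^ (d - 1) := by positivity
  have hblock' : max 1 Z * (C₂ ^ 2 * ((2 : ℝ) ^ (d - 1))⁻¹) * max 4 (2 * τ * ψ) ≤ 1 := by
    rw [show max 1 Z * (C₂ ^ 2 * ((2 : ℝ) ^ (d - 1))⁻¹) * max 4 (2 * τ * ψ) = max 1 Z * C₂ ^ 2 * max 4 (2 * τ * ψ) / (2 : ℝ) ^ (d - 1) by ring,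
      div_le_one h2d]
    exact hblock
  obtain ⟨⟨hQ'0, hQ0, hA0, _, _, _⟩, ⟨hF1, hF2, hF3, hF4, _, hF6, hF7⟩, ⟨hu₁, hu₂⟩, _, _⟩ :=
    towerLevNumericsG_rows hW hZ hκ0 hκQ hr1 hQb ha₁ hAb.le le_rfl hι₂ hX hρ hQ'' hQ ha hY hA hA' hι₃ hblock' amp1 amp2
  obtain ⟨hx₁, hx₂, hx₃, hy, hθ, hclose⟩ :=
    towerLevNumericsG_side_of_lam_le hσ hΦ hψ hτ hW hZ hκ0 hκQ hr1 hQb ha₁ hAb.le le_rfl hι₁ hι₂ hX hρ hQ'' hQ ha hY hA hA' hι₃ hblock' amp1 amp2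
      hlam.le hle
  -- the two floors in p4's literal shape
  have hA'1 : W * ((27 : ℝ) ^ 5 * (C₁ / C₂) * (8 : ℝ) ^ (d - 1) * (Ab + A / (1 - ((2 : ℝ) ^ d)⁻¹))) ≤ A' := by
    calc W * ((27 : ℝ) ^ 5 * (C₁ / C₂) * (8 : ℝ) ^ (d - 1) * (Ab + A / (1 - ((2 : ℝ) ^ d)⁻¹)))
        = κ * (Ab + A / (1 - ((2 : ℝ) ^ d)⁻¹)) := by rw [hκ]; ring
      _ ≤ A' := hF2
  have hQ'1 : Z * (C₂ ^ 2 * ((2 : ℝ) ^ (d - 1))⁻¹ * max Q Qb) ≤ Q' := by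
    calc Z * (C₂ ^ 2 * ((2 : ℝ) ^ (d - 1))⁻¹ * max Q Qb) = Z * (C₂ ^ 2 * ((2 : ℝ) ^ (d - 1))⁻¹) * max Q Qb := by ring
      _ ≤ Q' := hF4
  -- the block-1 profile from the base datum
  have hZQb : ∀ m : ℕ, (Z * Qb) ^ m ≤ Q' ^ m := fun m => pow_le_pow_left₀ (by positivity) hF3 m
  have hμ1 : ∀ m, 3 ≤ m → W * Z ^ m * klTowerMuLevF L M β U μ K d 1 m ≤ (W * (27 : ℝ) ^ 5 * Ab) * lam ^ (m - 1) * (Z * Qb) ^ m := by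
    intro m hm
    calc W * Z ^ m * klTowerMuLevF L M β U μ K d 1 m ≤ W * Z ^ m * ((27 : ℝ) ^ 5 * Ab * lam ^ (m - 1) * Qb ^ m) :=
          mul_le_mul_of_nonneg_left (klTowerMuLevF_one_le_of_baseRows hβ U μ K d hlam.le hAb.le hQb Nb hNb0 hcar hlawb hm) (by positivity)
      _ = (W * (27 : ℝ) ^ 5 * Ab) * lam ^ (m - 1) * (Z * Qb) ^ m := by rw [mul_pow]; ring
  have hbase : ∀ m, 4 ≤ m → m ≤ D → W * Z ^ m * klTowerMuLevF L M β U μ K d 1 m ≤ A' * lam ^ (m - 1) * Q' ^ m := by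
    intro m hm _
    refine (hμ1 m (by omega)).trans ?_
    exact mul_le_mul (mul_le_mul_of_nonneg_right hF1 (pow_nonneg hlam.le _)) (hZQb m) (by positivity) (by positivity)
  have hbase3 : 3 ≤ D → W * Z ^ 3 * klTowerMuLevF L M β U μ K d 1 3 ≤ ι₃ * lam ^ 2 := by
    intro _
    refine (hμ1 3 le_rfl).trans ?_
    calc (W * (27 : ℝ) ^ 5 * Ab) * lam ^ (3 - 1) * (Z * Qb) ^ 3 = ((W * (27 : ℝ) ^ 5 * Ab) * (Z * Qb) ^ 3) * lam ^ 2 := by norm_num; ring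
      _ ≤ (A' * Q' ^ 3) * lam ^ 2 :=
          mul_le_mul_of_nonneg_right (mul_le_mul hF1 (hZQb 3) (by positivity) (by positivity)) (sq_nonneg _)
      _ ≤ ι₃ * lam ^ 2 := mul_le_mul_of_nonneg_right hF7 (sq_nonneg _)
  exact h' P c hP hc hc6 hc₃' μ hμ U hU hU9 hU₀' β hβmin hβc K hK L M hL3 hM3 d Kb D hd hKbN hD A lam Q Ab Qb hA0.le hlam hQ0 hAb.le hQb Nb hNb0 hcar hlawb
    W Z A' Q' hW hZ hA'1 hQ'1 hQ'0 σ Φ ψ τ ι₁ ι₂ ι₃ X hσ hΦ hψ hτ hF6 hF7 hbase hbase3 himp₁ himp₂ hcell hstep hx₁ hx₂ hx₃ hy hθ hu₁ hu₂ hclose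

/-! ## §3 The doors form -/

/-- **THE FLOOR-KEYED RE-BASED LEVELLED TOWER LAW, NUMERICS CLOSED, DOORS FORM** (KL regime): at `λ := B·epsCoupling P U j` (`B > 0`, `j ≤ n`,
`IsKLRegime U cc (−n)`) the coupling smallness is the U-door `U ≤ λ₀/(2·B·Klam + 1)` and the c-door `cc ≤ λ₀·log 4/(2·B·Klam + 1)`; everything else as in
`klTowerBLevF_le_law_lev_of_rows`. [cite: BenfattoGiulianiMastropietro2006, §2.8 (2.83), (2.93)-(2.98)] -/
theorem klTowerBLevF_le_law_lev_of_doors :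
    ∃ C₁ C₂ : ℝ, 0 < C₁ ∧ 0 < C₂ ∧ ∀ R : RenConsts, R.WF2 → ∃ c₃' : ℝ, 0 < c₃' ∧ ∃ U₀' : ℝ, 0 < U₀' ∧
      ∀ (P : SplitConsts) (c : ℝ), P.WF → 0 < c → c ≤ klEngC₃6 P R → c ≤ c₃' →
      ∀ μ ∈ klWindowC, ∀ U : ℝ, 0 < U → U ≤ klEngU₀9 P R c → U ≤ U₀' → ∀ β : ℝ, klBetaMin ≤ β → β ≤ Real.exp (c / U ^ 2) →
      ∀ K : TrigPolyC4v, FrameOK R U (nScales β) μ K → ∀ (L M : ℕ) [NeZero L] [NeZero M],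
      klEngL₃ β U ≤ L → klEngM₃ β U L ≤ M → ∀ d Kb D : ℕ, 2 ≤ d → d * Kb - 1 ≤ nScales β + 1 → 3 ≤ D →
      ∀ (cc : ℝ) (n j : ℕ), IsKLRegime U cc (-(n : ℤ)) → j ≤ n →
      ∀ (B Ab Qb : ℝ), 0 < B → 0 < Ab → 0 ≤ Qb →
      -- the base datum at the family `F_{d−1}` and its unit law, at `λ = B·ε_j`
      ∀ Nb : Fin 5 → ℕ → ℝ, (∀ t p, 0 ≤ Nb t p) →
        (∀ (t : Fin 5) (p : ℕ) (Ωe' : Fin (2 * p) → Option (SectorLeg (sectorCount (d - 1)))), levelCount Ωe' = (t : ℕ) + 1 →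
          klLevNormOf L M β μ K (d - 1) (2 * p) (klTowerInput L M β U μ K d 1) Ωe' ≤ Nb t p) →
        (∀ (t : Fin 5) (p : ℕ), 3 ≤ p → Nb t p / klLevUnitF β M t p (d - 1) ≤ Ab * (B * epsCoupling P U j) ^ (p - 1) * Qb ^ p) →
      ∀ (W Z σ Φ ψ τ ι₁ ι₂ X : ℝ), 0 < W → 0 < Z → 0 ≤ σ → 0 ≤ Φ → 0 ≤ ψ → 0 < τ → 0 ≤ ι₁ → 0 ≤ ι₂ → 0 ≤ X →
      -- the explicit (I5)-F choices (equational binders)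
      ∀ (ρ Q' Q κ Y A A' ι₃ : ℝ), ρ = max 4 (2 * τ * ψ) → Q' = Z * Qb + 1 → Q = ρ * Q' →
        κ = W * ((27 : ℝ) ^ 5 * (C₁ / C₂) * (8 : ℝ) ^ (d - 1)) →
        Y = ι₂ / (2 * Q') + W * Z ^ 3 * X / (4 * Q' ^ 2) + (W * (27 : ℝ) ^ 5 * Ab + κ * Ab) * Q' / 2 →
        A = 2 * Y * (1 - ((2 : ℝ) ^ d)⁻¹) / (κ * Q') →
        A' = (W * (27 : ℝ) ^ 5 * Ab + κ * Ab) + 2 * Y / Q' → ι₃ = W * Z ^ 3 * X + A' * Q' ^ 3 →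
      -- the BLOCKING row and the two AMPLITUDE rows
      max 1 Z * C₂ ^ 2 * max 4 (2 * τ * ψ) ≤ (2 : ℝ) ^ (d - 1) → 8 * Φ * τ * Y ≤ 1 →
        128 * exp 1 * ψ ^ 3 * τ ^ 4 * Φ * κ * Y ≤ (1 - ((2 : ℝ) ^ d)⁻¹) * ρ ^ 3 →
      -- the imports (E1 (I4)) at `λ = B·ε_j`
      (∀ k, 1 ≤ k → k < Kb → W * Z ^ 1 * klTowerMuLevF L M β U μ K d k 1 ≤ ι₁ * (B * epsCoupling P U j)) →
      (∀ k, 1 ≤ k → k < Kb → W * Z ^ 2 * klTowerMuLevF L M β U μ K d k 2 ≤ ι₂ * (B * epsCoupling P U j)) →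
      -- the located six-leg cell «(I2)-F1-HMU» at the blocks `k ≥ 2`
      (∀ k, 2 ≤ k → k < Kb → klTowerMuLevAtF L M β U μ K d 0 k 3 ≤ X * (B * epsCoupling P U j) ^ 2) →
      -- the floor step at blocks `k ≥ 1` (the «(I1)-LEV-FLOOR» LINK)
      (∀ t : Fin 5, ∀ k, 1 ≤ k → k < Kb → ∀ N : ℕ, 2 ≤ N → ∀ p, 3 ≤ p → p ≤ D →
        Φ * towerV D τ (fun m => W * Z ^ m * klTowerMuLevF L M β U μ K d k m) < 1 →
        klTowerBLevF L M β U μ K d t (k + 1) p ≤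
          towerFO D σ (fun m => W * Z ^ m * klTowerMuLevF L M β U μ K d k m) p +
            ∑ n ∈ Icc 2 N, exp 1 * Φ ^ (n - 1) * ψ ^ p * towerS D τ (fun m => W * Z ^ m * klTowerMuLevF L M β U μ K d k m) n p +
            ψ ^ p * exp 1 * towerV D τ (fun m => W * Z ^ m * klTowerMuLevF L M β U μ K d k m) *
              (Φ * towerV D τ (fun m => W * Z ^ m * klTowerMuLevF L M β U μ K d k m)) ^ N /
              (1 - Φ * towerV D τ (fun m => W * Z ^ m * klTowerMuLevF L M β U μ K d k m))) →
      -- the two doors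
      U ≤ min 1 (min (1 / (8 * σ * Q' + 1)) (min (1 / (2 * exp 1 * τ * Q' + 1)) (min (1 / (4 * Φ * τ * ι₁ + 1))
        (min (1 / (2 * (Φ * (exp 1 * τ * ι₁ + (exp 1 * τ) ^ 2 * ι₂ + (exp 1 * τ) ^ 3 * ι₃ + A' * (exp 1 * τ * Q') ^ 2 / 2)) + 1))
          (min (A * Q ^ 3 / (16 * σ * Q' * A' * (4 * Q') ^ 3 + A * Q ^ 3))
            (A * Q ^ 3 / (16 * exp 1 * ψ * (2 * τ * ψ * Q') ^ 2 * Φ * τ ^ 2 * ι₁ ^ 2 + A * Q ^ 3))))))) / (2 * B * P.Klam + 1) →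
      cc ≤ min 1 (min (1 / (8 * σ * Q' + 1)) (min (1 / (2 * exp 1 * τ * Q' + 1)) (min (1 / (4 * Φ * τ * ι₁ + 1))
        (min (1 / (2 * (Φ * (exp 1 * τ * ι₁ + (exp 1 * τ) ^ 2 * ι₂ + (exp 1 * τ) ^ 3 * ι₃ + A' * (exp 1 * τ * Q') ^ 2 / 2)) + 1))
          (min (A * Q ^ 3 / (16 * σ * Q' * A' * (4 * Q') ^ 3 + A * Q ^ 3))
            (A * Q ^ 3 / (16 * exp 1 * ψ * (2 * τ * ψ * Q') ^ 2 * Φ * τ ^ 2 * ι₁ ^ 2 + A * Q ^ 3))))))) * Real.log 4 / (2 * B * P.Klam + 1) →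
      ∀ k, 2 ≤ k → k ≤ Kb → ∀ (t : Fin 5) (p : ℕ), 3 ≤ p → p ≤ D →
        klTowerBLevF L M β U μ K d t k p ≤ A * (B * epsCoupling P U j) ^ (p - 1) * Q ^ p := by
  obtain ⟨C₁, C₂, hC₁, hC₂, h⟩ := klTowerBLevF_le_law_of_base_rows
  refine ⟨C₁, C₂, hC₁, hC₂, fun R hR2 => ?_⟩
  obtain ⟨c₃, hc₃, U₀, hU₀, h'⟩ := h R hR2
  refine ⟨c₃, hc₃, U₀, hU₀, ?_⟩
  intro P c hP hc hc6 hc₃' μ hμ U hU hU9 hU₀' β hβmin hβc K hK L M _ _ hL3 hM3 d Kb D hd hKbN hD cc n j hreg hj B Ab Qb hB hAb hQb Nb hNb0 hcar hlawb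
    W Z σ Φ ψ τ ι₁ ι₂ X hW hZ hσ hΦ hψ hτ hι₁ hι₂ hX ρ Q' Q κ Y A A' ι₃ hρ hQ' hQ hκ hY hA hA' hι₃ hblock amp1 amp2 himp₁ himp₂ hcell hstep hUdoor hcdoor
  have hβ : 0 < β := KLRegimeSplit.pos_of_klBetaMin_le hβmin
  have hK1 : 1 ≤ P.Klam := hP.1
  have hK0 : 0 ≤ P.Klam := le_trans zero_le_one hK1
  have hε : 0 < epsCoupling P U j := by
    unfold epsCoupling
    have : 0 < |U| + U ^ 2 * (j : ℝ) := by positivity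
    positivity
  set lam : ℝ := B * epsCoupling P U j with hlamdef
  have hlam : 0 < lam := by positivity
  -- the generic (I5) rows
  have hκ0 : 0 < κ := by rw [hκ]; positivity
  have ha₁ : 0 < W * (27 : ℝ) ^ 5 * Ab := by positivity
  have hr1 : ((2 : ℝ) ^ d)⁻¹ < 1 := inv_lt_one_of_one_lt₀ (one_lt_pow₀ (by norm_num) (by omega))
  have hκQ : 0 ≤ C₂ ^ 2 * ((2 : ℝ) ^ (d - 1))⁻¹ := by positivity
  have hQ'' : Q' = Z * Qb + 0 + 1 := by rw [hQ', add_zero]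
  have ha : W * (27 : ℝ) ^ 5 * Ab + κ * Ab = W * (27 : ℝ) ^ 5 * Ab + κ * Ab := rfl
  have h2d : (0 : ℝ) < (2 : ℝ) ^ (d - 1) := by positivity
  have hblock' : max 1 Z * (C₂ ^ 2 * ((2 : ℝ) ^ (d - 1))⁻¹) * max 4 (2 * τ * ψ) ≤ 1 := by
    rw [show max 1 Z * (C₂ ^ 2 * ((2 : ℝ) ^ (d - 1))⁻¹) * max 4 (2 * τ * ψ) = max 1 Z * C₂ ^ 2 * max 4 (2 * τ * ψ) / (2 : ℝ) ^ (d - 1) by ring,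
      div_le_one h2d]
    exact hblock
  obtain ⟨⟨hQ'0, hQ0, hA0, _, _, _⟩, ⟨hF1, hF2, hF3, hF4, _, hF6, hF7⟩, ⟨hu₁, hu₂⟩, _, _⟩ :=
    towerLevNumericsG_rows hW hZ hκ0 hκQ hr1 hQb ha₁ hAb.le le_rfl hι₂ hX hρ hQ'' hQ ha hY hA hA' hι₃ hblock' amp1 amp2
  obtain ⟨hx₁, hx₂, hx₃, hy, hθ, hclose⟩ :=
    towerLevNumericsG_side_of_doors hK0 hσ hΦ hψ hτ hW hZ hκ0 hκQ hr1 hQb ha₁ hAb.le le_rfl hι₁ hι₂ hX hB.le hU.le hreg hj hρ hQ'' hQ ha hY hA hA' hι₃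
      hblock' amp1 amp2 hUdoor hcdoor
  -- the two floors in p4's literal shape
  have hA'1 : W * ((27 : ℝ) ^ 5 * (C₁ / C₂) * (8 : ℝ) ^ (d - 1) * (Ab + A / (1 - ((2 : ℝ) ^ d)⁻¹))) ≤ A' := by
    calc W * ((27 : ℝ) ^ 5 * (C₁ / C₂) * (8 : ℝ) ^ (d - 1) * (Ab + A / (1 - ((2 : ℝ) ^ d)⁻¹)))
        = κ * (Ab + A / (1 - ((2 : ℝ) ^ d)⁻¹)) := by rw [hκ]; ring
      _ ≤ A' := hF2
  have hQ'1 : Z * (C₂ ^ 2 * ((2 : ℝ) ^ (d - 1))⁻¹ * max Q Qb) ≤ Q' := by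
    calc Z * (C₂ ^ 2 * ((2 : ℝ) ^ (d - 1))⁻¹ * max Q Qb) = Z * (C₂ ^ 2 * ((2 : ℝ) ^ (d - 1))⁻¹) * max Q Qb := by ring
      _ ≤ Q' := hF4
  -- the block-1 profile from the base datum
  have hZQb : ∀ m : ℕ, (Z * Qb) ^ m ≤ Q' ^ m := fun m => pow_le_pow_left₀ (by positivity) hF3 m
  have hμ1 : ∀ m, 3 ≤ m → W * Z ^ m * klTowerMuLevF L M β U μ K d 1 m ≤ (W * (27 : ℝ) ^ 5 * Ab) * lam ^ (m - 1) * (Z * Qb) ^ m := by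
    intro m hm
    calc W * Z ^ m * klTowerMuLevF L M β U μ K d 1 m ≤ W * Z ^ m * ((27 : ℝ) ^ 5 * Ab * lam ^ (m - 1) * Qb ^ m) :=
          mul_le_mul_of_nonneg_left (klTowerMuLevF_one_le_of_baseRows hβ U μ K d hlam.le hAb.le hQb Nb hNb0 hcar hlawb hm) (by positivity)
      _ = (W * (27 : ℝ) ^ 5 * Ab) * lam ^ (m - 1) * (Z * Qb) ^ m := by rw [mul_pow]; ring
  have hbase : ∀ m, 4 ≤ m → m ≤ D → W * Z ^ m * klTowerMuLevF L M β U μ K d 1 m ≤ A' * lam ^ (m - 1) * Q' ^ m := by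
    intro m hm _
    refine (hμ1 m (by omega)).trans ?_
    exact mul_le_mul (mul_le_mul_of_nonneg_right hF1 (pow_nonneg hlam.le _)) (hZQb m) (by positivity) (by positivity)
  have hbase3 : 3 ≤ D → W * Z ^ 3 * klTowerMuLevF L M β U μ K d 1 3 ≤ ι₃ * lam ^ 2 := by
    intro _
    refine (hμ1 3 le_rfl).trans ?_
    calc (W * (27 : ℝ) ^ 5 * Ab) * lam ^ (3 - 1) * (Z * Qb) ^ 3 = ((W * (27 : ℝ) ^ 5 * Ab) * (Z * Qb) ^ 3) * lam ^ 2 := by norm_num; ring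
      _ ≤ (A' * Q' ^ 3) * lam ^ 2 :=
          mul_le_mul_of_nonneg_right (mul_le_mul hF1 (hZQb 3) (by positivity) (by positivity)) (sq_nonneg _)
      _ ≤ ι₃ * lam ^ 2 := mul_le_mul_of_nonneg_right hF7 (sq_nonneg _)
  exact h' P c hP hc hc6 hc₃' μ hμ U hU hU9 hU₀' β hβmin hβc K hK L M hL3 hM3 d Kb D hd hKbN hD A lam Q Ab Qb hA0.le hlam hQ0 hAb.le hQb Nb hNb0 hcar hlawb
    W Z A' Q' hW hZ hA'1 hQ'1 hQ'0 σ Φ ψ τ ι₁ ι₂ ι₃ X hσ hΦ hψ hτ hF6 hF7 hbase hbase3 himp₁ himp₂ hcell hstep hx₁ hx₂ hx₃ hy hθ hu₁ hu₂ hclose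

end Summit.HubbardSuperconductivity.HubbardSuperconductivity.Theorems.EngineV8
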